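import Mathlib
import Summits.Ventures.PercRepro2.RootPairSep

/-!
# Root-pair separation, Theorem 7 (iv): restriction to the piece
(blind cell PercRepro2, mine-2 g21; proofs/MINE2-CUTU.md §10 Theorem 7 (iv)).

If the roots `a₁, a₂` separate the vertex set (`IsRootPairSep`) and the three marks `o, u, b` all
lie on the side `V₁`, then every probability `P(X ∩ Q)` entering the cleared L-half of the weighted
(PM) factorises as `P(r₁⁻¹(X ∩ Q)) · P(r₂⁻¹ Q)` (`prob_inter_compl_eq_restrict_mul`), where `r₁`
closes the edges outside `V₁` and `r₂` closes the edges inside `V₁`.  Hence the cleared L-half of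
the whole graph equals `P(r₂⁻¹ Q)³` times the cleared L-half of the piece `G[V₁]` — the same
expression with every connection event read in the restricted configuration
(`halfL_eq_mul_restrict`), and the two are nonnegative together as soon as `P(r₂⁻¹ Q) > 0`
(`halfL_nonneg_iff_restrict`).  Together with (i)–(iii) (`RootPairSepPM.lean`) this reduces the
weighted (PM) L-half to the blocks containing both roots and all three marks.
-/

namespace Summit.Ventures.PercRepro2

namespace RootPairSep

open SepPair

section Prob

variable {V : Type*} {E : Type*} [Fintype E] [DecidableEq E] {R : Type*} [CommRing R]

/-- **Factorisation across the root pair.**  If `X` is determined by the edges of `V₁` on `Q`,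
then `P(X ∩ Q) = P(r₁⁻¹(X ∩ Q)) · P(r₂⁻¹ Q)`. -/
theorem prob_inter_compl_eq_restrict_mul (p : E → R) {ends : E → Sym2 V} {a₁ a₂ : V}
    {V₁ V₂ : Set V} (hs : IsRootPairSep ends a₁ a₂ V₁ V₂) [DecidablePred (· ∈ side₁ ends V₁)]
    [DecidablePred (· ∈ (side₁ ends V₁)ᶜ)] {X : Set (Config E)}
    (hX : ∀ ω ∈ (connEvent ends a₁ a₂)ᶜ, ω ∈ X ↔ restrictTo (side₁ ends V₁) ω ∈ X) :
    prob p (X ∩ (connEvent ends a₁ a₂)ᶜ) =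
      prob p (restrictTo (side₁ ends V₁) ⁻¹' (X ∩ (connEvent ends a₁ a₂)ᶜ)) *
        prob p (restrictTo (side₁ ends V₁)ᶜ ⁻¹' (connEvent ends a₁ a₂)ᶜ) := by
  have hDω := fun ω => compl_conn_iff_restrict hs (ω := ω)
  have ind : ∀ A B : Set (Config E),
      prob p (restrictTo (side₁ ends V₁) ⁻¹' A ∩ restrictTo (side₁ ends V₁)ᶜ ⁻¹' B) =
        prob p (restrictTo (side₁ ends V₁) ⁻¹' A) * prob p (restrictTo (side₁ ends V₁)ᶜ ⁻¹' B) :=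
    fun A B => prob_inter_eq_mul_of_dependsOn p disjoint_compl_right
      (dependsOn_restrictTo _ A) (dependsOn_restrictTo _ B)
  have e : X ∩ (connEvent ends a₁ a₂)ᶜ =
      restrictTo (side₁ ends V₁) ⁻¹' (X ∩ (connEvent ends a₁ a₂)ᶜ) ∩
        restrictTo (side₁ ends V₁)ᶜ ⁻¹' (connEvent ends a₁ a₂)ᶜ := by
    ext ω
    have := hDω ω; have := hX ω
    simp only [Set.mem_inter_iff, Set.mem_preimage]
    tauto
  exact (congrArg (prob p) e).trans (ind _ _)

/-- `P(Q) = P(r₁⁻¹ Q) · P(r₂⁻¹ Q)`. -/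
theorem prob_compl_conn_eq_restrict_mul (p : E → R) {ends : E → Sym2 V} {a₁ a₂ : V}
    {V₁ V₂ : Set V} (hs : IsRootPairSep ends a₁ a₂ V₁ V₂) [DecidablePred (· ∈ side₁ ends V₁)]
    [DecidablePred (· ∈ (side₁ ends V₁)ᶜ)] :
    prob p (connEvent ends a₁ a₂)ᶜ =
      prob p (restrictTo (side₁ ends V₁) ⁻¹' (connEvent ends a₁ a₂)ᶜ) *
        prob p (restrictTo (side₁ ends V₁)ᶜ ⁻¹' (connEvent ends a₁ a₂)ᶜ) := by
  have h := prob_inter_compl_eq_restrict_mul p hs (X := Set.univ)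
    (fun _ _ => by simp only [Set.mem_univ])
  simpa only [Set.univ_inter] using h

end Prob

section Main

variable {V : Type*} {E : Type*} [Fintype E] [DecidableEq E] {R : Type*} [CommRing R]

/-- **Theorem 7 (iv).**  If `o`, `u`, `b` all lie on the side `V₁` of the root pair, the cleared
L-half of the weighted (PM) equals `P(r₂⁻¹ Q)³` times the cleared L-half of the piece `G[V₁]`,
i.e. the same expression with every connection event read in the configuration restricted to the
edges of `V₁`. -/
theorem halfL_eq_mul_restrict (p : E → R) {ends : E → Sym2 V} {a₁ a₂ : V}
    {V₁ V₂ : Set V} (hs : IsRootPairSep ends a₁ a₂ V₁ V₂) [DecidablePred (· ∈ side₁ ends V₁)]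
    [DecidablePred (· ∈ (side₁ ends V₁)ᶜ)] {o u b : V}
    (ho : o ∈ V₁) (hu : u ∈ V₁) (hb : b ∈ V₁) :
    prob p (connEvent ends a₁ a₂)ᶜ *
          (prob p (connEvent ends a₁ a₂)ᶜ *
              prob p (connEvent ends a₁ b ∩ connEvent ends a₂ u ∩
                (connEvent ends a₁ o ∪ connEvent ends a₂ o) ∩ (connEvent ends a₁ a₂)ᶜ) -
            prob p (connEvent ends a₁ b ∩ (connEvent ends a₁ a₂)ᶜ) *
              prob p (connEvent ends a₂ u ∩ (connEvent ends a₁ o ∪ connEvent ends a₂ o) ∩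
                (connEvent ends a₁ a₂)ᶜ)) -
        prob p ((connEvent ends a₁ o ∪ connEvent ends a₂ o) ∩ (connEvent ends a₁ a₂)ᶜ) *
          (prob p (connEvent ends a₁ a₂)ᶜ *
              prob p (connEvent ends a₁ b ∩ connEvent ends a₂ u ∩ (connEvent ends a₁ a₂)ᶜ) -
            prob p (connEvent ends a₁ b ∩ (connEvent ends a₁ a₂)ᶜ) *
              prob p (connEvent ends a₂ u ∩ (connEvent ends a₁ a₂)ᶜ)) -
        prob p (connEvent ends a₁ a₂)ᶜ *
          (prob p (connEvent ends a₁ a₂)ᶜ *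
              prob p (connEvent ends a₁ b ∩ connEvent ends a₂ o ∩ (connEvent ends a₁ a₂)ᶜ) -
            prob p (connEvent ends a₁ b ∩ (connEvent ends a₁ a₂)ᶜ) *
              prob p (connEvent ends a₂ o ∩ (connEvent ends a₁ a₂)ᶜ)) =
      prob p (restrictTo (side₁ ends V₁)ᶜ ⁻¹' (connEvent ends a₁ a₂)ᶜ) ^ 3 *
        (prob p (restrictTo (side₁ ends V₁) ⁻¹' (connEvent ends a₁ a₂)ᶜ) *
            (prob p (restrictTo (side₁ ends V₁) ⁻¹' (connEvent ends a₁ a₂)ᶜ) *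
                prob p (restrictTo (side₁ ends V₁) ⁻¹'
                  (connEvent ends a₁ b ∩ connEvent ends a₂ u ∩
                    (connEvent ends a₁ o ∪ connEvent ends a₂ o) ∩ (connEvent ends a₁ a₂)ᶜ)) -
              prob p (restrictTo (side₁ ends V₁) ⁻¹'
                  (connEvent ends a₁ b ∩ (connEvent ends a₁ a₂)ᶜ)) *
                prob p (restrictTo (side₁ ends V₁) ⁻¹'
                  (connEvent ends a₂ u ∩ (connEvent ends a₁ o ∪ connEvent ends a₂ o) ∩
                    (connEvent ends a₁ a₂)ᶜ))) -
          prob p (restrictTo (side₁ ends V₁) ⁻¹'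
              ((connEvent ends a₁ o ∪ connEvent ends a₂ o) ∩ (connEvent ends a₁ a₂)ᶜ)) *
            (prob p (restrictTo (side₁ ends V₁) ⁻¹' (connEvent ends a₁ a₂)ᶜ) *
                prob p (restrictTo (side₁ ends V₁) ⁻¹'
                  (connEvent ends a₁ b ∩ connEvent ends a₂ u ∩ (connEvent ends a₁ a₂)ᶜ)) -
              prob p (restrictTo (side₁ ends V₁) ⁻¹'
                  (connEvent ends a₁ b ∩ (connEvent ends a₁ a₂)ᶜ)) *
                prob p (restrictTo (side₁ ends V₁) ⁻¹'
                  (connEvent ends a₂ u ∩ (connEvent ends a₁ a₂)ᶜ))) -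
          prob p (restrictTo (side₁ ends V₁) ⁻¹' (connEvent ends a₁ a₂)ᶜ) *
            (prob p (restrictTo (side₁ ends V₁) ⁻¹' (connEvent ends a₁ a₂)ᶜ) *
                prob p (restrictTo (side₁ ends V₁) ⁻¹'
                  (connEvent ends a₁ b ∩ connEvent ends a₂ o ∩ (connEvent ends a₁ a₂)ᶜ)) -
              prob p (restrictTo (side₁ ends V₁) ⁻¹'
                  (connEvent ends a₁ b ∩ (connEvent ends a₁ a₂)ᶜ)) *
                prob p (restrictTo (side₁ ends V₁) ⁻¹'
                  (connEvent ends a₂ o ∩ (connEvent ends a₁ a₂)ᶜ)))) := by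
  classical
  set D := (connEvent ends a₁ a₂)ᶜ with hDdef
  set Lb := connEvent ends a₁ b
  set Hu := connEvent ends a₂ u
  set Lo := connEvent ends a₁ o
  set Ho := connEvent ends a₂ o
  -- all four marks' connections live on side 1
  have sLb : ∀ ω ∈ D, ω ∈ Lb ↔ restrictTo (side₁ ends V₁) ω ∈ Lb :=
    fun _ hD => conn_side₁ hs hD (Or.inl rfl) hb
  have sHu : ∀ ω ∈ D, ω ∈ Hu ↔ restrictTo (side₁ ends V₁) ω ∈ Hu :=
    fun _ hD => conn_side₁ hs hD (Or.inr rfl) hu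
  have sLo : ∀ ω ∈ D, ω ∈ Lo ↔ restrictTo (side₁ ends V₁) ω ∈ Lo :=
    fun _ hD => conn_side₁ hs hD (Or.inl rfl) ho
  have sHo : ∀ ω ∈ D, ω ∈ Ho ↔ restrictTo (side₁ ends V₁) ω ∈ Ho :=
    fun _ hD => conn_side₁ hs hD (Or.inr rfl) ho
  have soU := side_union sLo sHo
  -- the nine factorisations
  have F0 := prob_compl_conn_eq_restrict_mul p hs
  have F1 := prob_inter_compl_eq_restrict_mul p hs (X := Lb ∩ Hu ∩ (Lo ∪ Ho))
    (side_inter (side_inter sLb sHu) soU)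
  have F2 := prob_inter_compl_eq_restrict_mul p hs (X := Lb) sLb
  have F3 := prob_inter_compl_eq_restrict_mul p hs (X := Hu ∩ (Lo ∪ Ho)) (side_inter sHu soU)
  have F4 := prob_inter_compl_eq_restrict_mul p hs (X := Lo ∪ Ho) soU
  have F5 := prob_inter_compl_eq_restrict_mul p hs (X := Lb ∩ Hu) (side_inter sLb sHu)
  have F6 := prob_inter_compl_eq_restrict_mul p hs (X := Hu) sHu
  have F7 := prob_inter_compl_eq_restrict_mul p hs (X := Lb ∩ Ho) (side_inter sLb sHo)
  have F8 := prob_inter_compl_eq_restrict_mul p hs (X := Ho) sHo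
  rw [F0, F1, F2, F3, F4, F5, F6, F7, F8]
  ring

/-- **Theorem 7 (iv), sign form.**  When `o`, `u`, `b` all lie on the side `V₁` and
`P(r₂⁻¹ Q) > 0`, the cleared L-half of the whole graph is nonnegative iff the cleared L-half of
the piece `G[V₁]` is. -/
theorem halfL_nonneg_iff_restrict [LinearOrder R] [IsStrictOrderedRing R] (p : E → R)
    {ends : E → Sym2 V} {a₁ a₂ : V} {V₁ V₂ : Set V} (hs : IsRootPairSep ends a₁ a₂ V₁ V₂)
    [DecidablePred (· ∈ side₁ ends V₁)] [DecidablePred (· ∈ (side₁ ends V₁)ᶜ)] {o u b : V}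
    (ho : o ∈ V₁) (hu : u ∈ V₁) (hb : b ∈ V₁)
    (hpos : 0 < prob p (restrictTo (side₁ ends V₁)ᶜ ⁻¹' (connEvent ends a₁ a₂)ᶜ)) :
    0 ≤ prob p (connEvent ends a₁ a₂)ᶜ *
          (prob p (connEvent ends a₁ a₂)ᶜ *
              prob p (connEvent ends a₁ b ∩ connEvent ends a₂ u ∩
                (connEvent ends a₁ o ∪ connEvent ends a₂ o) ∩ (connEvent ends a₁ a₂)ᶜ) -
            prob p (connEvent ends a₁ b ∩ (connEvent ends a₁ a₂)ᶜ) *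
              prob p (connEvent ends a₂ u ∩ (connEvent ends a₁ o ∪ connEvent ends a₂ o) ∩
                (connEvent ends a₁ a₂)ᶜ)) -
        prob p ((connEvent ends a₁ o ∪ connEvent ends a₂ o) ∩ (connEvent ends a₁ a₂)ᶜ) *
          (prob p (connEvent ends a₁ a₂)ᶜ *
              prob p (connEvent ends a₁ b ∩ connEvent ends a₂ u ∩ (connEvent ends a₁ a₂)ᶜ) -
            prob p (connEvent ends a₁ b ∩ (connEvent ends a₁ a₂)ᶜ) *
              prob p (connEvent ends a₂ u ∩ (connEvent ends a₁ a₂)ᶜ)) -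
        prob p (connEvent ends a₁ a₂)ᶜ *
          (prob p (connEvent ends a₁ a₂)ᶜ *
              prob p (connEvent ends a₁ b ∩ connEvent ends a₂ o ∩ (connEvent ends a₁ a₂)ᶜ) -
            prob p (connEvent ends a₁ b ∩ (connEvent ends a₁ a₂)ᶜ) *
              prob p (connEvent ends a₂ o ∩ (connEvent ends a₁ a₂)ᶜ)) ↔
      0 ≤ prob p (restrictTo (side₁ ends V₁) ⁻¹' (connEvent ends a₁ a₂)ᶜ) *
            (prob p (restrictTo (side₁ ends V₁) ⁻¹' (connEvent ends a₁ a₂)ᶜ) *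
                prob p (restrictTo (side₁ ends V₁) ⁻¹'
                  (connEvent ends a₁ b ∩ connEvent ends a₂ u ∩
                    (connEvent ends a₁ o ∪ connEvent ends a₂ o) ∩ (connEvent ends a₁ a₂)ᶜ)) -
              prob p (restrictTo (side₁ ends V₁) ⁻¹'
                  (connEvent ends a₁ b ∩ (connEvent ends a₁ a₂)ᶜ)) *
                prob p (restrictTo (side₁ ends V₁) ⁻¹'
                  (connEvent ends a₂ u ∩ (connEvent ends a₁ o ∪ connEvent ends a₂ o) ∩
                    (connEvent ends a₁ a₂)ᶜ))) -
          prob p (restrictTo (side₁ ends V₁) ⁻¹'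
              ((connEvent ends a₁ o ∪ connEvent ends a₂ o) ∩ (connEvent ends a₁ a₂)ᶜ)) *
            (prob p (restrictTo (side₁ ends V₁) ⁻¹' (connEvent ends a₁ a₂)ᶜ) *
                prob p (restrictTo (side₁ ends V₁) ⁻¹'
                  (connEvent ends a₁ b ∩ connEvent ends a₂ u ∩ (connEvent ends a₁ a₂)ᶜ)) -
              prob p (restrictTo (side₁ ends V₁) ⁻¹'
                  (connEvent ends a₁ b ∩ (connEvent ends a₁ a₂)ᶜ)) *
                prob p (restrictTo (side₁ ends V₁) ⁻¹'
                  (connEvent ends a₂ u ∩ (connEvent ends a₁ a₂)ᶜ))) -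
          prob p (restrictTo (side₁ ends V₁) ⁻¹' (connEvent ends a₁ a₂)ᶜ) *
            (prob p (restrictTo (side₁ ends V₁) ⁻¹' (connEvent ends a₁ a₂)ᶜ) *
                prob p (restrictTo (side₁ ends V₁) ⁻¹'
                  (connEvent ends a₁ b ∩ connEvent ends a₂ o ∩ (connEvent ends a₁ a₂)ᶜ)) -
              prob p (restrictTo (side₁ ends V₁) ⁻¹'
                  (connEvent ends a₁ b ∩ (connEvent ends a₁ a₂)ᶜ)) *
                prob p (restrictTo (side₁ ends V₁) ⁻¹'
                  (connEvent ends a₂ o ∩ (connEvent ends a₁ a₂)ᶜ))) := by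
  rw [halfL_eq_mul_restrict p hs ho hu hb]
  have h3 : 0 < prob p (restrictTo (side₁ ends V₁)ᶜ ⁻¹' (connEvent ends a₁ a₂)ᶜ) ^ 3 :=
    pow_pos hpos 3
  exact ⟨fun h => nonneg_of_mul_nonneg_right h h3, fun h => mul_nonneg h3.le h⟩

end Main

end RootPairSep

end Summit.Ventures.PercRepro2
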